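import Mathlib
import Literature.NumberTheory.Transcendental.KZDirichletCharts
import Literature.NumberTheory.Transcendental.KZBetaUnitExponent
import Literature.NumberTheory.Transcendental.KZBallVolume
import Literature.NumberTheory.Transcendental.SemialgebraicVolume
import HarnessLib
import HarnessLib.Audit

/-!
# SoloInformed — Euler's lemniscate relation inside the Kontsevich–Zagier rules

Theorem IX of the residency paper (§6octies), kernel part (a): the QUADRATIC period relation of the
lemniscate — Euler 1738 / Legendre's relation at the CM point `i` —
`B(¼,½) · B(¾,½) = 4π`, i.e. `∫₀¹ dt/√(1−t⁴) · ∫₀¹ t² dt/√(1−t⁴) = π/4`, holds between the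
CLASSES in the formal period ring `P = KZ.FormalPeriodRing` (representations modulo the three
Kontsevich–Zagier moves), unconditionally:

* `soloInformed_dirichlet_reassociation` — **Dirichlet's re-association is a theorem of the
  calculus**: for all positive rationals `a, b, c` and representations pinned as the four Beta
  integrals, `⟦β(a,b)⟧·⟦β(a+b,c)⟧ = ⟦β(b,c)⟧·⟦β(a,b+c)⟧` in `P`.  This DISCHARGES the standing
  hypothesis `hdir` of `Literature/…/KZBallVolume.lean` (there taken as an explicit hypothesis of
  the disc and ball theorems): the two Dirichlet charts of `KZDirichletCharts.lean` through the open
  simplex, composed with the cube/product identification `KZ.cubeBetaRep_toFormalPeriod_eq_prod`.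
* `soloInformed_toFormalPeriod_piRep_eq_betaHalf` — **`⟦[disc, 1]⟧ = ⟦β(½,½)⟧`** for KZ's own
  representation `KZ.piRep` of `π` (closed unit disc), unconditionally (the ball theorem of
  `KZBallVolume.lean` at `e = 0` with `hdir` discharged, plus the null circle).
* `soloInformed_euler_lemniscate` — **`⟦β(¼,½)⟧ · ⟦β(¾,½)⟧ = 4 · ⟦π⟧` in `P`**
  (Dirichlet at `(a,b,c) = (¼,½,½)` and `β(¼,1) ∼ [pt, 4]`), and its value shadow
  `soloInformed_value_betaQuarter_mul_value_betaThreeQuarter`: `B(¼,½)·B(¾,½) = 4π`.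

Why this matters for the conjecture (paper §6octies): `KZP ⟺ GPC ∧ PiCancellation` localises, sector
by sector, to "the evaluation map `P ⊇ A → ℝ` is injective on the sub-ring `A`"; on the lemniscate
sector `A = ℤ[⟦β(¼,½)⟧, ⟦β(¾,½)⟧, ⟦π⟧]` the only relation among the values is Euler's (Chudnovsky
1976: `π, Γ(¼)` algebraically independent — a tree theorem), so the sector is decided exactly when
Euler's relation is DERIVABLE by the moves; this file derives it (sibling file
`SoloInformedLemniscateSector.lean` assembles the decision).  First decided sector of the conjecture
carrying a non-linear period relation.  Residency `solo-KontsevichZagierPeriods-informed` (s22).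

References: L. Euler, *De miris proprietatibus curvae elasticae* (1786) [E605] (`∫dx/√(1−x⁴)·∫x²dx/√(1−x⁴)
= π/4`); G. E. Andrews, R. Askey, R. Roy, *Special Functions* (1999), Thm. 1.8.1; M. Kontsevich,
D. Zagier, *Periods* (2001), §1.1–1.2, §4.1; G. V. Chudnovsky, *Contributions to the theory of
transcendental numbers* (1984), Ch. 7.
-/

noncomputable section

open MeasureTheory Set Filter
namespace Summit.KontsevichZagierPeriods.KontsevichZagierPeriods.Theorems

open Literature.NumberTheory.Transcendental Literature.NumberTheory.Transcendental.KZ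
open Literature.ModelTheory.ExponentialFields

/-! ### Dirichlet's re-association, unconditionally -/

/-- The cube `(0,1)²` in the two spellings used by the Literature files. -/
theorem soloInformed_box_two_eq :
    {t : Fin 2 → ℝ | ∀ j, t j ∈ Set.Ioo (0:ℝ) 1} =
      {z : Fin 2 → ℝ | z 0 ∈ Set.Ioo (0:ℝ) 1 ∧ z 1 ∈ Set.Ioo (0:ℝ) 1} := by
  ext z
  simp only [mem_setOf_eq, Fin.forall_fin_two]

/-- **Dirichlet's re-association inside the rules.** For positive rationals `a, b, c` and
representations pinned as `β₁ = β(a,b)`, `β₂ = β(a+b,c)`, `β₃ = β(b,c)`, `β₄ = β(a,b+c)`: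
`⟦β₁⟧·⟦β₂⟧ = ⟦β₃⟧·⟦β₄⟧` in the formal period ring.  Chain: `⟦β₂⟧⟦β₁⟧ = ⟦[(0,1)², u^{a+b-1}(1-u)^{c-1}
v^{a-1}(1-v)^{b-1}]⟧` (cube product) `∼ [Δ, x^{a-1}y^{b-1}(1-x-y)^{c-1}]` (polar chart)
`∼ [(0,1)², t^{b-1}(1-t)^{c-1} u^{a-1}(1-u)^{b+c-1}]` (linear chart) `= ⟦β₃⟧⟦β₄⟧`.  The binder shape is
that of the hypothesis `hdir` of `KZ.BallPeeling.natCast_add_one_mul_toFormalPeriod_disc`.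
[Andrews–Askey–Roy 1999, Thm. 1.8.1; Kontsevich–Zagier 2001, §1.2] -/
theorem soloInformed_dirichlet_reassociation (a b c : ℚ) (ha : 0 < a) (hb : 0 < b) (hc : 0 < c)
    (β₁ β₂ β₃ β₄ : IntegralRep 1)
    (h₁d : β₁.domain = {t | t 0 ∈ Set.Ioo (0:ℝ) 1})
    (h₁i : Set.EqOn β₁.integrand
      (fun t => (t 0) ^ ((a : ℝ) - 1) * (1 - t 0) ^ ((b : ℝ) - 1)) β₁.domain)
    (h₂d : β₂.domain = {t | t 0 ∈ Set.Ioo (0:ℝ) 1})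
    (h₂i : Set.EqOn β₂.integrand
      (fun t => (t 0) ^ (((a + b : ℚ) : ℝ) - 1) * (1 - t 0) ^ ((c : ℝ) - 1)) β₂.domain)
    (h₃d : β₃.domain = {t | t 0 ∈ Set.Ioo (0:ℝ) 1})
    (h₃i : Set.EqOn β₃.integrand
      (fun t => (t 0) ^ ((b : ℝ) - 1) * (1 - t 0) ^ ((c : ℝ) - 1)) β₃.domain)
    (h₄d : β₄.domain = {t | t 0 ∈ Set.Ioo (0:ℝ) 1})
    (h₄i : Set.EqOn β₄.integrand
      (fun t => (t 0) ^ ((a : ℝ) - 1) * (1 - t 0) ^ (((b + c : ℚ) : ℝ) - 1)) β₄.domain) :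
    toFormalPeriod (of β₁) * toFormalPeriod (of β₂) =
      toFormalPeriod (of β₃) * toFormalPeriod (of β₄) := by
  have hab : 0 < a + b := add_pos ha hb
  have hbc : 0 < b + c := add_pos hb hc
  have hposP : ∀ j, 0 < (![a + b, a] : Fin 2 → ℚ) j ∧ 0 < (![c, b] : Fin 2 → ℚ) j := by
    intro j; fin_cases j
    · exact ⟨hab, hc⟩
    · exact ⟨ha, hb⟩
  have hposB : ∀ j, 0 < (![b, a] : Fin 2 → ℚ) j ∧ 0 < (![c, b + c] : Fin 2 → ℚ) j := by
    intro j; fin_cases j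
    · exact ⟨hb, hc⟩
    · exact ⟨ha, hbc⟩
  -- the two box representations
  obtain ⟨P, hPd, hPi⟩ := exists_cubeBetaRep ![a + b, a] ![c, b] hposP
  obtain ⟨B, hBd, hBi⟩ := exists_cubeBetaRep ![b, a] ![c, b + c] hposB
  -- their classes are the products of the Beta classes
  have hP : toFormalPeriod (of P) = toFormalPeriod (of β₂) * toFormalPeriod (of β₁) := by
    rw [cubeBetaRep_toFormalPeriod_eq_prod ![a + b, a] ![c, b] hposP P ![β₂, β₁] hPd hPi
      (fun j => by fin_cases j <;> simp [h₂d, h₁d]) (fun j => ?_), Fin.prod_univ_two]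
    · rfl
    · fin_cases j
      · intro t ht
        simp only [Fin.zero_eta, Fin.isValue, Matrix.cons_val_zero] at ht ⊢
        rw [h₂i ht]
      · intro t ht
        simp only [Fin.mk_one, Fin.isValue, Matrix.cons_val_one, Matrix.cons_val_fin_one] at ht ⊢
        rw [h₁i ht]
  have hB : toFormalPeriod (of B) = toFormalPeriod (of β₃) * toFormalPeriod (of β₄) := by
    rw [cubeBetaRep_toFormalPeriod_eq_prod ![b, a] ![c, b + c] hposB B ![β₃, β₄] hBd hBi
      (fun j => by fin_cases j <;> simp [h₃d, h₄d]) (fun j => ?_), Fin.prod_univ_two]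
    · rfl
    · fin_cases j
      · intro t ht
        simp only [Fin.zero_eta, Fin.isValue, Matrix.cons_val_zero] at ht ⊢
        rw [h₃i ht]
      · intro t ht
        simp only [Fin.mk_one, Fin.isValue, Matrix.cons_val_one, Matrix.cons_val_fin_one] at ht ⊢
        rw [h₄i ht]
  -- the integrands in the spelling of the two charts
  have hPi' : Set.EqOn P.integrand (fun z => (z 0) ^ ((a : ℝ) + b - 1) * (1 - z 0) ^ ((c : ℝ) - 1) *
      ((z 1) ^ ((a : ℝ) - 1) * (1 - z 1) ^ ((b : ℝ) - 1))) P.domain := by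
    intro z hz
    rw [hPi hz]
    simp only [Fin.prod_univ_two, Fin.isValue, Matrix.cons_val_zero, Matrix.cons_val_one,
      Rat.cast_add]
  have hBi' : Set.EqOn B.integrand (fun z => (z 0) ^ ((b : ℝ) - 1) * (1 - z 0) ^ ((c : ℝ) - 1) *
      ((z 1) ^ ((a : ℝ) - 1) * (1 - z 1) ^ ((b : ℝ) + c - 1))) B.domain := by
    intro z hz
    rw [hBi hz]
    simp only [Fin.prod_univ_two, Fin.isValue, Matrix.cons_val_zero, Matrix.cons_val_one,
      Rat.cast_add]
  -- the two charts through the simplex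
  obtain ⟨S, hSd, hSi, hPS⟩ :=
    dirichletPolar_equivalent a b c P (hPd.trans soloInformed_box_two_eq) hPi'
  have hSB : Equivalent S B :=
    dirichletLinear_equivalent a b c S B hSd hSi (hBd.trans soloInformed_box_two_eq) hBi'
  calc toFormalPeriod (of β₁) * toFormalPeriod (of β₂)
      = toFormalPeriod (of P) := by rw [hP, mul_comm]
    _ = toFormalPeriod (of B) := (hPS.trans hSB).toFormalPeriod_eq
    _ = toFormalPeriod (of β₃) * toFormalPeriod (of β₄) := hB

/-! ### `⟦π⟧ = ⟦β(½,½)⟧` -/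

/-- The unit circle `{x² + y² = 1} ⊆ ℝ²` is `ℚ`-semialgebraic. [folklore] -/
theorem isSemialgebraic_soloInformedCircle :
    IsSemialgebraic ℚ {z : Fin 2 → ℝ | ∑ i, (z i) ^ 2 = 1} := by
  have h := isSemialgebraic_setOf_eval_eq_zero (k := ℚ) (R := ℝ)
    (∑ i, MvPolynomial.X i ^ 2 - 1 : MvPolynomial (Fin 2) ℚ)
  convert h using 1
  ext z
  simp only [mem_setOf_eq, map_sub, map_sum, map_pow, MvPolynomial.aeval_X, map_one, sub_eq_zero]

/-- The unit circle is Lebesgue-null (zero set of the non-zero polynomial `x² + y² − 1`). [folklore] -/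
theorem volume_soloInformedCircle :
    volume {z : Fin 2 → ℝ | ∑ i, (z i) ^ 2 = 1} = 0 := by
  have h := volume_setOf_aeval_eq_zero (k := ℚ)
    (∑ i, MvPolynomial.X i ^ 2 - 1 : MvPolynomial (Fin 2) ℚ) (by
      intro h0
      have h1 := congr_arg (MvPolynomial.eval (0 : Fin 2 → ℝ)) h0
      simp at h1)
  convert h using 1
  congr 1
  ext z
  simp only [mem_setOf_eq, map_sub, map_sum, map_pow, MvPolynomial.aeval_X, map_one, sub_eq_zero]

/-- The circle representation `[{x² + y² = 1}, 1]` (value `0`). -/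
def soloInformedCircleRep : IntegralRep 2 where
  domain := {z : Fin 2 → ℝ | ∑ i, (z i) ^ 2 = 1}
  integrand := fun _ => 1
  isSemialgebraic_domain := isSemialgebraic_soloInformedCircle
  isSemialgebraicFunOn_integrand := by
    simpa using isSemialgebraicFunOn_aeval isSemialgebraic_soloInformedCircle
      (1 : MvPolynomial (Fin 2) ℚ)
  integrableOn := by
    rw [IntegrableOn, Measure.restrict_eq_zero.mpr volume_soloInformedCircle]
    exact integrable_zero_measure

/-- **Closed disc versus open disc**: KZ's `[disc, 1]` (closed unit disc) and a representation pinned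
as `[{|w|² < 1}, (1 − |w|²)⁰]` differ by a relation (domain additivity over the null circle, and a
null-domain representation is a relation). [Kontsevich–Zagier 2001, §1.2 rule (1)] -/
theorem soloInformed_piRep_sub_openDisc_mem_relations (D : IntegralRep 2)
    (hDd : D.domain = {w | ∑ i, (w i) ^ 2 < 1})
    (hDi : D.integrand = fun w => (1 - ∑ i, (w i) ^ 2) ^ (0 : ℕ)) :
    of KZ.piRep - of D ∈ relations := by
  have h1 : of KZ.piRep - of D - of soloInformedCircleRep ∈ relations := by
    refine domainAddRel_subset_relations ⟨2, KZ.piRep, D, soloInformedCircleRep, ?_, ?_, ?_, ?_, rfl⟩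
    · rw [piRep_domain, hDd]
      ext z
      simp only [mem_piDisc, Fin.sum_univ_two, soloInformedCircleRep, mem_union, mem_setOf_eq]
      exact le_iff_lt_or_eq
    · exact measure_mono_null inter_subset_right volume_soloInformedCircle
    · intro w _
      simp [hDi]
    · intro w _
      simp [soloInformedCircleRep]
  have h2 : of soloInformedCircleRep ∈ relations :=
    of_mem_relations_of_volume_eq_zero _ volume_soloInformedCircle
  have : of KZ.piRep - of D = (of KZ.piRep - of D - of soloInformedCircleRep) +
      of soloInformedCircleRep := by abel
  rw [this]
  exact relations.add_mem h1 h2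

/-- **`⟦[disc, 1]⟧ = ⟦β(½,½)⟧`, unconditionally**: for a representation `H` pinned as
`β(½,½) = [(0,1), (t(1−t))^{−1/2}]`, `⟦KZ.piRep⟧ = ⟦H⟧` in the formal period ring — the disc theorem
of `KZBallVolume.lean` (`(e+1)·⟦[disc,(1−|w|²)^e]⟧ = ⟦β(½,½)⟧`) at `e = 0`, its hypothesis `hdir`
discharged by `soloInformed_dirichlet_reassociation`, and the null circle. Value: `π = B(½,½)`.
[Kontsevich–Zagier 2001, §1.1] -/
theorem soloInformed_toFormalPeriod_piRep_eq_betaHalf (H : IntegralRep 1)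
    (hHd : H.domain = {t | t 0 ∈ Set.Ioo (0:ℝ) 1})
    (hHi : Set.EqOn H.integrand
      (fun t => (t 0) ^ (((1 / 2 : ℚ) : ℝ) - 1) * (1 - t 0) ^ (((1 / 2 : ℚ) : ℝ) - 1)) H.domain) :
    toFormalPeriod (of KZ.piRep) = toFormalPeriod (of H) := by
  obtain ⟨D, hDd, hDi⟩ := BallPeeling.exists_ballRep 2 0
  have hdisc := BallPeeling.natCast_add_one_mul_toFormalPeriod_disc 0 D H hDd
    (fun w _ => by rw [hDi]) hHd hHi soloInformed_dirichlet_reassociation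
  rw [Nat.cast_zero, zero_add, one_mul] at hdisc
  rw [← hdisc]
  exact toFormalPeriod_eq_iff.mpr (soloInformed_piRep_sub_openDisc_mem_relations D hDd hDi)

/-! ### Euler's lemniscate relation -/

/-- `⟦[pt, 4]⟧ = 4`, for the point representation written with the constant `((1/4 : ℚ) : ℝ)⁻¹`. -/
theorem soloInformed_toFormalPeriod_unit_constMul_inv_quarter
    (h : IsAlgebraic ℚ (((1 / 4 : ℚ) : ℝ)⁻¹)) :
    toFormalPeriod (of (IntegralRep.unit.constMul (((1 / 4 : ℚ) : ℝ)⁻¹) h)) = 4 := by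
  have key : ∀ (x : ℝ) (hx : IsAlgebraic ℚ x), x = ((4 : ℕ) : ℝ) →
      toFormalPeriod (of (IntegralRep.unit.constMul x hx)) = 4 := by
    rintro x hx rfl
    rw [toFormalPeriod_of_unit_constMul_natCast 4 hx]
    norm_num
  exact key _ h (by norm_num)

/-- **Euler's lemniscate relation inside the rules** (Theorem IX(a)): for representations pinned as
`B₁ = β(¼,½) = [(0,1), t^{−3/4}(1−t)^{−1/2}]` and `B₃ = β(¾,½) = [(0,1), t^{−1/4}(1−t)^{−1/2}]`,
`⟦B₁⟧ · ⟦B₃⟧ = 4 · ⟦[disc, 1]⟧` in the formal period ring: Dirichlet at `(¼,½,½)` gives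
`⟦β(¼,½)⟧⟦β(¾,½)⟧ = ⟦β(½,½)⟧⟦β(¼,1)⟧`, `⟦β(½,½)⟧ = ⟦π⟧` and `β(¼,1) ∼ [pt, 4]`
(`KZ.betaFirst_equivalent_unit_constMul`).  With `t = x⁴`: `4∫₀¹dx/√(1−x⁴) = B(¼,½)`,
`4∫₀¹x²dx/√(1−x⁴) = B(¾,½)` — Euler's `∫₀¹ dx/√(1−x⁴) · ∫₀¹ x²dx/√(1−x⁴) = π/4`.
[Euler E605; Andrews–Askey–Roy 1999, Thm. 1.8.1; Kontsevich–Zagier 2001, §1.2] -/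
theorem soloInformed_euler_lemniscate (B₁ B₃ : IntegralRep 1)
    (h₁d : B₁.domain = {t | t 0 ∈ Set.Ioo (0:ℝ) 1})
    (h₁i : Set.EqOn B₁.integrand
      (fun t => (t 0) ^ (((1 / 4 : ℚ) : ℝ) - 1) * (1 - t 0) ^ (((1 / 2 : ℚ) : ℝ) - 1)) B₁.domain)
    (h₃d : B₃.domain = {t | t 0 ∈ Set.Ioo (0:ℝ) 1})
    (h₃i : Set.EqOn B₃.integrand
      (fun t => (t 0) ^ (((3 / 4 : ℚ) : ℝ) - 1) * (1 - t 0) ^ (((1 / 2 : ℚ) : ℝ) - 1)) B₃.domain) :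
    toFormalPeriod (of B₁) * toFormalPeriod (of B₃) = 4 * toFormalPeriod (of KZ.piRep) := by
  have hq : (0 : ℚ) < 1 / 4 := by norm_num
  have hh : (0 : ℚ) < 1 / 2 := by norm_num
  obtain ⟨H, hHd, hHi⟩ := exists_betaRep' (1 / 2) (1 / 2) hh hh
  obtain ⟨β₄, h₄d, h₄i⟩ := exists_betaRep' (1 / 4) 1 hq one_pos
  have hdir := soloInformed_dirichlet_reassociation (1 / 4) (1 / 2) (1 / 2) hq hh hh B₁ B₃ H β₄
    h₁d h₁i h₃d (fun t ht => by rw [h₃i ht]; norm_num) hHd (fun t _ => by rw [hHi])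
    h₄d (fun t _ => by rw [h₄i]; norm_num)
  have h4 : IsAlgebraic ℚ (((1 / 4 : ℚ) : ℝ)⁻¹) := by
    rw [← Rat.cast_inv]
    exact isAlgebraic_algebraMap _
  have hβ₄ : toFormalPeriod (of β₄) = 4 := by
    rw [(betaFirst_equivalent_unit_constMul (1 / 4) hq β₄ h₄d (fun t _ => by rw [h₄i])
      h4).toFormalPeriod_eq]
    exact soloInformed_toFormalPeriod_unit_constMul_inv_quarter h4
  rw [hdir, hβ₄, soloInformed_toFormalPeriod_piRep_eq_betaHalf H hHd (fun t _ => by rw [hHi]),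
    mul_comm]

/-- **Value shadow**: `B(¼,½) · B(¾,½) = 4π` for the values of the two pinned representations
(evaluate `soloInformed_euler_lemniscate` by `KZ.evalP`). [Euler E605] -/
theorem soloInformed_value_betaQuarter_mul_value_betaThreeQuarter (B₁ B₃ : IntegralRep 1)
    (h₁d : B₁.domain = {t | t 0 ∈ Set.Ioo (0:ℝ) 1})
    (h₁i : Set.EqOn B₁.integrand
      (fun t => (t 0) ^ (((1 / 4 : ℚ) : ℝ) - 1) * (1 - t 0) ^ (((1 / 2 : ℚ) : ℝ) - 1)) B₁.domain)
    (h₃d : B₃.domain = {t | t 0 ∈ Set.Ioo (0:ℝ) 1})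
    (h₃i : Set.EqOn B₃.integrand
      (fun t => (t 0) ^ (((3 / 4 : ℚ) : ℝ) - 1) * (1 - t 0) ^ (((1 / 2 : ℚ) : ℝ) - 1)) B₃.domain) :
    B₁.value * B₃.value = 4 * Real.pi := by
  have h := congr_arg evalP (soloInformed_euler_lemniscate B₁ B₃ h₁d h₁i h₃d h₃i)
  simpa only [map_mul, evalP_toFormalPeriod_of, piRep_value, map_ofNat] using h

end Summit.KontsevichZagierPeriods.KontsevichZagierPeriods.Theorems

end
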